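import Summits.Langlands.Langlands.Theorems.SplitPrimeDescentLadderResidual

/-!
# SplitPrimeDescentLadder, v4 — the DYADIC GRADE of the residual door (lens «grading / quantitative ladder», g36)

(decomp-langlands cell, lens-1 lineage `SplitPrimeDescentLadder` v1 → v2b (`Theorems.SplitPrimeDescentLadder`) → v3
residual currency (`Theorems.SplitPrimeDescentLadderResidual`) → THIS add-on module.  Typed-not-filed node; 0 sorry;
the deciding theorems `langlands_of_pieces_dyadic` / `closes_target_dyadic` conclude `_root_.Langlands` BY NAME.
Nothing here proves Langlands: rung 0, nine open pieces and one decided piece.)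

## The grading (lens brief: «write the blocker as a conjunction graded by a parameter; the grade where theorems stop»)

After the g35 births landed (T1 field supply `Theorems.SplitPrimeDescentLadderFieldSupply`, T2 twist/model
`Theorems.SplitPrimeDescentLadderTwistModel`, both PROVED), the v3 door `CofinalResidualDoor` (D∞') is carried by ONE
open stub T3 = «the finite-image projectively icosahedral `3`-adic model `τ₃` of `σ|_M` is residually automorphic in
the completed cohomology of `GL₂` over the imaginary member field `M` at `p = 3`» — Serre's conjecture over CM fields in
torsion formulation, IDEA-NEEDED: no printed theorem has that shape for restrictions of EVEN `ρ̄`.  The whole lineage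
fixed the RESIDUAL PRIME `r = 3` (`2·A₅ ⊂ SL₂(F₉)`).  This node GRADES THE DOOR BY `r ∈ {2, 3, 5}` — the three
exceptional isomorphisms of `A₅` — and reads off where theorems stop:

* `r = 3` (`2·A₅ ⊂ SL₂(F₉)`): Serre-type conjecture over CM fields — IDEA-NEEDED (v3, unchanged).  Kept below ONLY for
  the `2`-bad sub-sector, as the restricted door `CofinalResidualDoorOffDyadic` (D₃♭).
* `r = 5` (`A₅ ≅ PSL₂(F₅)`; the elliptic-curve door of Allen–Khare–Thorne arXiv:1910.12986 Prop 9.12 / Thm 9.16 at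
  `p = 5` IS print): DEAD for a deciding ladder.  A `GL₂(F₅)`-valued twist of `σ̄₅|_M` with projective image
  `PSL₂(F₅)` has determinant `ω₅|_M` of order `≤ 2`, i.e. forces `√5 ∈ M` (Pilloni, Invent. math. 2016, Lemme 4.8.3
  passes to `F' ∋ √5` for exactly this reason); then EVERY member of the cofinal family contains `ℚ(√5)` and the last
  cyclic-descent step `ℚ(√5) → ℚ` of the EVEN point leaves the quadratic ambiguity `{π₀, π₀ ⊗ χ₅}` which (i) family
  variation cannot kill (the character is common to all members), (ii) Tunnell's trick cannot resolve (`A₅` has no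
  proper subgroup of index `< 5`; the Galois closure is not soluble), and (iii) only Galois data attached to `π₀` would
  resolve (available in regular weight by Clifford pinning; absent for a Maass-type point): the icosahedral/Maass barrier
  in another costume — recorded as a cell barrier note («real-quadratic core ⟹ sign ambiguity for even points»).
* `r = 2` (`A₅ ≅ SL₂(F₄)`): NO determinant twist (`ω₂ = 1`; units of `F̄₂` have unique square roots) and NO `√5 ∈ M`;
  the door becomes a PRINT CHAIN — Shepherd-Barron–Taylor 1997 (`ρ̄ : G_K → SL₂(F₄)` is `A[2]` for a principally
  polarised abelian surface `A/K` with `ℤ[(1+√5)/2] ↪ End_K(A)`, Hilbert irreducibility making `A[√5]` surjective onto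
  `GL₂(F₅)`: Taylor, Pacific J. Math. 181 (1997) p. 344) ∘ (cyclotomic determinant of `A[√5]` from the RM Weil pairing)
  ∘ AKT Prop 9.12 (the 2–3-switch analogue at `5`: soluble CM `L/M` avoiding a given field, modular `E/L` with
  `ρ̄_{E,5} ≅ A[√5]|_L`, Tate at `w ∣ 5`) ∘ AKT Thm 8.1 (ordinary automorphy lifting at the odd prime `5` over the CM
  field `L`; image `⊇ SL₂(F₅)` allowed when `ζ₅ ∉` the projective field, automatic for `[M(ζ₅):M] = 4`) ∘ soluble
  descent `L → M` of the weight-`0` compatible system of `A` (as in AKT Cor 9.13) ∘ bookkeeping (cuspidal cohomological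
  `π_A` ⟹ non-Eisenstein `𝔪 ⊂ 𝕋(U^2)` with `ρ̄_𝔪 ≅ A[2]`, `2` inert in `ℤ[(1+√5)/2]`).  Its fine print is the
  ATTACKABLE content: SBT's moduli construction over a number field `K` (printed over `ℚ`; the twisted Hilbert modular
  surface is rational over any `K`), ordinary members above `5` plus weak approximation, decomposed genericity of
  `A[√5]|_L`.  THE PRICE OF THE GRADE: the ENGINE and the WALL must be cloned at `p = 2`
  (`ShapePreservingResidualEngineTwo`, `ClassicalityOffBadPlacesTwo`, same tags as E∞'/F∞ — `2`-adic patching with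
  residual image `SL₂(F₄)` is if anything harder), and the dyadic branch only serves `2`-GOOD `σ` (unramified at `2`,
  projective `Frob₂` of order `3` or `5` — the eigenvalue ratio `-1` is NOT `2`-adically distinguished, hence
  `t ≠ 0 ∧ t² ≠ 4d`); the descent H∞ `CofinalCyclicDescent` is `p`-free and reused BY NAME, and the member shape
  (Galois, cyclic, squarefree degree, imaginary quadratic core `ℚ(√-d)`, now `d ≡ 7 (mod 8)` so that `2` splits) is
  unchanged, so no `√5` enters and the `r = 5` obstruction does not arise.

  GRADED TABLE (door stub T3 at residual prime `r`; entries = status of «finite-image projectively-`A₅` `r`-adic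
  representations of `Γ_M`, `M` imaginary CM of the family shape, are residually automorphic in `H̃•` at `p = r`»):
  `r = 2`: ATTACKABLE (print chain, 5 links, 3 pieces of fine print) — `r = 3`: IDEA-NEEDED (no theorem) —
  `r = 5`: statement PRINT (AKT §9) but UNUSABLE (forces `√5 ∈ M`; descent sign barrier) — `r ≥ 7`: no exceptional
  isomorphism, `A₅ ⊄ PGL₂(F_r)`-theory gives nothing new (Serre-type conjecture again).  Theorems stop between `r = 2`
  and `r = 3`.

## Pieces (v4) and tags — ROOT `Langlands` ⟸ D₂ ∧ E₂ ∧ F₂ ∧ D₃♭ ∧ E∞' ∧ F∞ ∧ G∞ ∧ H∞ ∧ C ∧ J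

* `CofinalResidualDoorTwo` (D₂, NEW) — D∞' at the residual prime `2`: for `2`-good `σ`, cofinitely in `p`, a member
  field `M`, a character `χ`, `τ = χ ⊗ σ|_M` and a `2`-adic model `τ₂` (finite image, projectively `A₅`, unramified with
  `2`-adically distinct Frobenius eigenvalues above `2`; `χ, τ₂` unramified above `p`) RESIDUALLY AUTOMORPHIC IN
  COMPLETED COHOMOLOGY AT `p = 2` (`TameLevel 2 M 2`, non-Eisenstein `𝔪`, `ρ̄_𝔪` a reduction of `τ₂`).  WEAKER than
  ROOT (strictly, in the cell's sense: not summit-implied — an Artin `π` is non-cohomological and its trace in `𝕋(U^2)`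
  is Hansen's Conj. 1.2.3 — and it does not give an automorphic `π` over `ℚ`).  UNDECIDED vs D∞' (different prime,
  different `σ`-sector; neither implication is a tree theorem).  Leaf ATTACKABLE — split in the kit's birth file
  `birth_CofinalResidualDoorTwo.lean` as D₂ ⟸ T1₂ (field supply, ATTACKABLE: clone of the landed T1 with
  `D + 1 = 8·3·5·p₀·∏ℓᵢ`) ∧ T2₂ (twist/model, ATTACKABLE: clone of the landed T2 with `χ = 1`) ∧ RM₂ («finite-image
  projectively icosahedral `2`-adic representations of `Γ_M`, `M` CM with `ζ₅ ∉ M(?)`/`√5 ∉ M`, unramified with distinct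
  eigenvalues above `2`, are residually automorphic at `p = 2`», ATTACKABLE = the print chain above).
* `ShapePreservingResidualEngineTwo` (E₂, NEW) — E∞' at `p = 2` (same text, `3 ↦ 2`, `d ≡ 2 (3) ↦ d ≡ 7 (8)`,
  `ζ₃`-clause dropped).  WEAKER than ROOT (as E∞').  Leaf NEEDS-BREAKTHROUGH (ordinary `2`-adic patching of completed
  cohomology at a non-Eisenstein `𝔪` with `ρ̄_𝔪(Γ_M) ≅ SL₂(F₄)`; torsion weight part / level optimisation over CM; the
  only `p = 2` automorphy lifting theorem over CM fields, AKT 2020, needs dihedral `ρ̄`).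
* `ClassicalityOffBadPlacesTwo` (F₂, NEW) — F∞ at `p = 2`.  Leaf BARRIER-class (non-cohomological classicality over CM
  fields), as F∞ / `ArtinPointClassicalityCM` (14075).  WEAKER than ROOT in the sense of F∞ (one sector; not known to
  imply ROOT; implied by nothing in the tree).
* `CofinalResidualDoorOffDyadic` (D₃♭, NEW text) — D∞' with the extra hypothesis «`σ` is NOT `2`-good».  WEAKER than
  D∞' (certificate `cofinalResidualDoorOffDyadic_of_cofinalResidualDoor`; strictly: silent on the generic `2`-good
  sector).  Leaf IDEA-NEEDED (T3 on the thin `2`-bad class only).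
* E∞' `ShapePreservingResidualEngine` (NEEDS-BREAKTHROUGH), F∞ `ClassicalityOffBadPlaces` (BARRIER-class), G∞
  `UntwistAutomorphyAt` (PROVED: `untwistAutomorphyAt_proof`), H∞ `CofinalCyclicDescent` (ATTACKABLE), C =
  `NonDistinguishedComplement` (stmt 14078), J = `SectorJunction` (stmt 13565): BY NAME, unchanged.

«Why this decomposition is novel»: no node of the cell varies the residual prime; at `r = 2` — and only there — the
icosahedral residual representation needs neither a determinant twist nor `√5`, so v3's open Serre-type door is
replaced, on the generic (`2`-good) sector, by the Shepherd-Barron–Taylor/Allen–Khare–Thorne print chain, while the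
`r = 5` grade is shown to be excluded by the real-quadratic-core descent obstruction.  «Why each NEW piece is strictly
weaker than ROOT»: D₂ and E₂ are statements about completed cohomology at `p = 2` which an Artin `π` does not supply
(Hansen Conj. 1.2.3) and which do not give an automorphic `π` over `ℚ`; F₂ is a classicality statement for `2`-adic
Artin points over CM fields, one sector of one sub-problem; D₃♭ is D∞' restricted to a sub-sector.  Kernel:
`langlands_of_pieces_dyadic` = the v3 glue run twice under `by_cases` on `2`-goodness (`2`-good: D₂ → E₂ → F₂ → G∞ →
H∞; `2`-bad ∧ `3`-good: D₃♭ → E∞' → F∞ → G∞ → H∞; `3`-bad: C), joined by J; `closes_target_dyadic` discharges G∞.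

Sources: [arXiv:1910.12986 Thm 8.1 (p. 56), Prop 9.12 (p. 61), Cor 9.13–9.15 (p. 62), Thm 9.16 (p. 63)];
[doi:10.2140/pjm.1997.181.337 p. 344]; [ShepherdBarronTaylor1997 = doi:10.1090/S0894-0347-97-00226-9, §§1–3];
[doi:10.1007/s00222-016-0697-x Prop 4.8.2, Lemme 4.8.3]; [HansenUniversalEigenvarieties2017 Conj. 1.2.3];
[GeeNewton2020 §3.3]; [KhareThorne2017 Thm 6.30]; [arXiv:1212.3847].
-/

set_option linter.dupNamespace false -- project-wide option; `Summit.Langlands.Langlands` is the mandated namespace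
noncomputable section
namespace Summit.Langlands.Langlands.Theorems.SplitPrimeDescentLadder
open Summit.Langlands.Langlands.Theses.EvenIcosahedralCMCorner

/-- **D₂ `CofinalResidualDoorTwo`** (v4) — the door at the residual prime `2`: D∞' `CofinalResidualDoor` with `3 ↦ 2`
(`2`-good `σ`: unramified at `2`, `t ≠ 0 ∧ t² ≠ 4d`; member clause `d ≡ 7 (mod 8)`, i.e. `2` split in `ℚ(√-d)`; no
`ζ₃`-clause; `2`-adic model `τ₂`, `‖t² - 4d‖₂ = 1` above `2`; `TameLevel 2 M 2`).  Leaf ATTACKABLE (print chain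
SBT97 → RM Weil pairing → AKT Prop 9.12 → AKT Thm 8.1 → soluble descent → Franke/Borel–Serre bookkeeping; split in the
kit's birth file as T1₂ ∧ T2₂ ∧ RM₂).  Why it might fail: Shepherd-Barron–Taylor's realisation `ρ̄ ≅ A[2]` is printed over
`ℚ` (Taylor PJM 1997 p. 344) and must run over the CM member field; the ordinary lifting at `5` needs `A` ordinary above
`5` (weak approximation on the rational twisted family).  NOT summit-implied.  [ShepherdBarronTaylor1997; arXiv:1910.12986
Prop 9.12, Thm 8.1, Cor 9.13; doi:10.2140/pjm.1997.181.337 §3; GeeNewton2020 §3.3] -/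
def CofinalResidualDoorTwo : Prop :=
  ∀ (ι : PadicAlgCl 2 ≃+* ℂ) (σ : Literature.NumberTheory.GaloisRepresentations.FramedGaloisRep ℚ ℂ 2), σ.toGaloisRep.IsIrreducible → Nonempty ((Matrix.ProjGenLinGroup.mk.comp σ.toMonoidHom).range ≃* alternatingGroup (Fin 5)) → (∀ (φ : ℚ →+* ℝ) (c : Field.absoluteGaloisGroup ℚ), Literature.NumberTheory.GaloisRepresentations.IsComplexConjugation φ c → Matrix.GeneralLinearGroup.det (σ c) = 1) → (∀ v : IsDedekindDomain.HeightOneSpectrum (NumberField.RingOfIntegers ℚ), (2 : NumberField.RingOfIntegers ℚ) ∈ v.asIdeal → σ.IsUnramifiedAt v ∧ ∃ t d : ℂ, σ.HasFrobCharpolyAt v (Polynomial.X ^ 2 - Polynomial.C t * Polynomial.X + Polynomial.C d) ∧ t ≠ 0 ∧ t ^ 2 ≠ 4 * d) → ∀ᶠ p : IsDedekindDomain.HeightOneSpectrum (NumberField.RingOfIntegers ℚ) in Filter.cofinite, ∃ (M : Type) (_ : Field M) (_ : NumberField M), NumberField.IsCMField M ∧ IsGalois ℚ M ∧ IsCyclic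 (M ≃ₐ[ℚ] M) ∧ Squarefree (Module.finrank ℚ M) ∧ (∀ ℓ : ℕ, ℓ.Prime → ℓ ∣ Module.finrank ℚ M → ℓ = 2 ∨ (2 ^ Ideal.absNorm p.asIdeal ≤ ℓ ∧ ℓ < 2 ^ (Ideal.absNorm p.asIdeal + 1))) ∧ (∀ w : IsDedekindDomain.HeightOneSpectrum (NumberField.RingOfIntegers M), w.asIdeal.under (NumberField.RingOfIntegers ℚ) = p.asIdeal → w.asIdeal.inertiaDeg (NumberField.RingOfIntegers ℚ) = 1 ∧ w.asIdeal.ramificationIdx (NumberField.RingOfIntegers ℚ) = 1) ∧ (∃ (d : ℕ) (z : M), d % 8 = 7 ∧ z ^ 2 + (d : M) = 0) ∧ ∃ (χ : Literature.NumberTheory.GaloisRepresentations.FramedGaloisRep M ℂ 1) (τ : Literature.NumberTheory.GaloisRepresentations.FramedGaloisRep M ℂ 2) (τ₂ : Literature.NumberTheory.GaloisRepresentations.FramedGaloisRep M (PadicAlgCl 2) 2), (∀ g : Field.absoluteGaloisGroup M, ((τ g : Matrix.GeneralLinearGroup (Fin 2) ℂ) : Matrix (Fin 2) (Fin 2) ℂ)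 = ((Matrix.GeneralLinearGroup.det (χ g) : ℂˣ) : ℂ) • ((Literature.NumberTheory.GaloisRepresentations.FramedGaloisRep.restrictField M σ g : Matrix.GeneralLinearGroup (Fin 2) ℂ) : Matrix (Fin 2) (Fin 2) ℂ)) ∧ (∀ g : Field.absoluteGaloisGroup M, ((τ₂ g : Matrix.GeneralLinearGroup (Fin 2) (PadicAlgCl 2)) : Matrix (Fin 2) (Fin 2) (PadicAlgCl 2)).map ι = ((τ g : Matrix.GeneralLinearGroup (Fin 2) ℂ) : Matrix (Fin 2) (Fin 2) ℂ)) ∧ Finite τ₂.toMonoidHom.range ∧ (∀ w : IsDedekindDomain.HeightOneSpectrum (NumberField.RingOfIntegers M), w.asIdeal.under (NumberField.RingOfIntegers ℚ) = p.asIdeal → χ.IsUnramifiedAt w ∧ τ₂.IsUnramifiedAt w) ∧ (Nonempty ((Matrix.ProjGenLinGroup.mk.comp τ₂.toMonoidHom).range ≃* alternatingGroup (Fin 5)) ∧ (∀ w : IsDedekindDomain.HeightOneSpectrum (NumberField.RingOfIntegers M), (2 : NumberField.RingOfIntegers M) ∈ w.asIdeal → τ₂.IsUnramifiedAt w ∧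 ∃ t d : PadicAlgCl 2, τ₂.HasFrobCharpolyAt w (Polynomial.X ^ 2 - Polynomial.C t * Polynomial.X + Polynomial.C d) ∧ ‖t ^ 2 - 4 * d‖ = 1) ∧ ∃ 𝒰 : Literature.NumberTheory.Automorphic.BigHeckeGLn.TameLevel 2 M 2, ∃ 𝔪 : Ideal (Literature.NumberTheory.Automorphic.CompletedCohomologyHeckeAlgebraGLn 𝒰), 𝒰.IsNonEisenstein 𝔪 ∧ ∃ (k : Type) (_ : Field k) (_ : TopologicalSpace k) (_ : DiscreteTopology k) (ιk : Literature.NumberTheory.GaloisRepresentations.padicAlgClResidueField 2 →+* k) (ψ : Literature.NumberTheory.Automorphic.CompletedCohomologyHeckeAlgebraGLn 𝒰 →+* k) (ρ : Literature.NumberTheory.GaloisRepresentations.FramedGaloisRep M k 2), 𝒰.IsResidualRepAt 𝔪 ψ ρ ∧ τ₂.IsReductionOf ιk (ρ : Field.absoluteGaloisGroup M →* Matrix.GeneralLinearGroup (Fin 2) k))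

/-- **E₂ `ShapePreservingResidualEngineTwo`** (v4) — E∞' `ShapePreservingResidualEngine` at `p = 2` (`3 ↦ 2`; member clause
`d ≡ 7 (mod 8)`; `ζ₃`-clause dropped): residual automorphy of the finite-image projectively icosahedral `τ₂` in completed
cohomology at `p = 2` ⟹ `2`-adic pro-automorphy over a CM `M' ⊇ M` of the same shape at a tame level unramified above
`p`.  Leaf NEEDS-BREAKTHROUGH (ordinary `2`-adic patching at a non-Eisenstein `𝔪` with `ρ̄_𝔪(Γ_M) ≅ SL₂(F₄)`; torsion
weight part and level optimisation over CM fields).  Why it might fail: the only automorphy lifting theorem at `p = 2`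
over CM fields (AKT 2020) needs dihedral `ρ̄`; `SL₂(F₄)` is not `2`-adequate.  NOT summit-implied.  [arXiv:1910.12986;
KhareThorne2017 Thm 6.30; arXiv:1212.3847] -/
def ShapePreservingResidualEngineTwo : Prop :=
  ∀ (M : Type) [Field M] [NumberField M] (p : IsDedekindDomain.HeightOneSpectrum (NumberField.RingOfIntegers ℚ)), NumberField.IsCMField M → IsGalois ℚ M → IsCyclic (M ≃ₐ[ℚ] M) → Squarefree (Module.finrank ℚ M) → (∀ ℓ : ℕ, ℓ.Prime → ℓ ∣ Module.finrank ℚ M → ℓ = 2 ∨ (2 ^ Ideal.absNorm p.asIdeal ≤ ℓ ∧ ℓ < 2 ^ (Ideal.absNorm p.asIdeal + 1))) → (∀ w : IsDedekindDomain.HeightOneSpectrum (NumberField.RingOfIntegers M), w.asIdeal.under (NumberField.RingOfIntegers ℚ) = p.asIdeal → w.asIdeal.inertiaDeg (NumberField.RingOfIntegers ℚ) = 1 ∧ w.asIdeal.ramificationIdx (NumberField.RingOfIntegers ℚ) = 1) → (∃ (d : ℕ) (z : M), d % 8 = 7 ∧ z ^ 2 + (d : M) = 0) → ∀ τ₂ :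 Literature.NumberTheory.GaloisRepresentations.FramedGaloisRep M (PadicAlgCl 2) 2, Finite τ₂.toMonoidHom.range → (∀ w : IsDedekindDomain.HeightOneSpectrum (NumberField.RingOfIntegers M), w.asIdeal.under (NumberField.RingOfIntegers ℚ) = p.asIdeal → τ₂.IsUnramifiedAt w) → (Nonempty ((Matrix.ProjGenLinGroup.mk.comp τ₂.toMonoidHom).range ≃* alternatingGroup (Fin 5)) ∧ (∀ w : IsDedekindDomain.HeightOneSpectrum (NumberField.RingOfIntegers M), (2 : NumberField.RingOfIntegers M) ∈ w.asIdeal → τ₂.IsUnramifiedAt w ∧ ∃ t d : PadicAlgCl 2, τ₂.HasFrobCharpolyAt w (Polynomial.X ^ 2 - Polynomial.C t * Polynomial.X + Polynomial.C d) ∧ ‖t ^ 2 - 4 * d‖ = 1) ∧ ∃ 𝒰 : Literature.NumberTheory.Automorphic.BigHeckeGLn.TameLevel 2 M 2, ∃ 𝔪 : Ideal (Literature.NumberTheory.Automorphic.CompletedCohomologyHeckeAlgebraGLn 𝒰), 𝒰.IsNonEisenstein 𝔪 ∧ ∃ (k : Type) (_ : Field k) (_ : TopologicalSpace k) (_ :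 DiscreteTopology k) (ιk : Literature.NumberTheory.GaloisRepresentations.padicAlgClResidueField 2 →+* k) (ψ : Literature.NumberTheory.Automorphic.CompletedCohomologyHeckeAlgebraGLn 𝒰 →+* k) (ρ : Literature.NumberTheory.GaloisRepresentations.FramedGaloisRep M k 2), 𝒰.IsResidualRepAt 𝔪 ψ ρ ∧ τ₂.IsReductionOf ιk (ρ : Field.absoluteGaloisGroup M →* Matrix.GeneralLinearGroup (Fin 2) k)) → ∃ (M' : Type) (_ : Field M') (_ : NumberField M') (_ : Algebra M M'), NumberField.IsCMField M' ∧ IsGalois ℚ M' ∧ IsCyclic (M' ≃ₐ[ℚ] M') ∧ Squarefree (Module.finrank ℚ M') ∧ (∀ ℓ : ℕ, ℓ.Prime → ℓ ∣ Module.finrank ℚ M' → ℓ = 2 ∨ (2 ^ Ideal.absNorm p.asIdeal ≤ ℓ ∧ ℓ < 2 ^ (Ideal.absNorm p.asIdeal + 1))) ∧ (∀ w : IsDedekindDomain.HeightOneSpectrum (NumberField.RingOfIntegers M'), w.asIdeal.under (NumberField.RingOfIntegers ℚ) = p.asIdeal → w.asIdeal.inertiaDeg (NumberField.RingOfIntegers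 ℚ) = 1 ∧ w.asIdeal.ramificationIdx (NumberField.RingOfIntegers ℚ) = 1) ∧ Finite (Literature.NumberTheory.GaloisRepresentations.FramedGaloisRep.restrictField M' τ₂).toMonoidHom.range ∧ Nonempty ((Matrix.ProjGenLinGroup.mk.comp (Literature.NumberTheory.GaloisRepresentations.FramedGaloisRep.restrictField M' τ₂).toMonoidHom).range ≃* alternatingGroup (Fin 5)) ∧ ∃ 𝒰 : Literature.NumberTheory.Automorphic.BigHeckeGLn.TameLevel 2 M' 2, (∀ w : IsDedekindDomain.HeightOneSpectrum (NumberField.RingOfIntegers M'), w.asIdeal.under (NumberField.RingOfIntegers ℚ) = p.asIdeal → w ∉ 𝒰.bad) ∧ 𝒰.IsPadicallyAutomorphic (Literature.NumberTheory.GaloisRepresentations.FramedGaloisRep.restrictField M' τ₂)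

/-- **F₂ `ClassicalityOffBadPlacesTwo`** (v4) — F∞ `ClassicalityOffBadPlaces` at `p = 2` (`3 ↦ 2`): a finite-image
projectively icosahedral `2`-adic Artin point of the completed cohomology of `GL₂` over a CM field is classical with
local–global compatibility off the bad places.  Leaf BARRIER-class (non-cohomological classicality over CM fields), as
F∞ / `ArtinPointClassicalityCM` (14075).  Why it might fail: no classicality theorem in non-cohomological weight over CM
fields at any `p`.  [HansenUniversalEigenvarieties2017 Conj. 1.2.3; GeeNewton2020 §3.3] -/
def ClassicalityOffBadPlacesTwo : Prop :=
  ∀ (ι : PadicAlgCl 2 ≃+* ℂ) (M : Type) [Field M] [NumberField M], NumberField.IsCMField M → ∀ (τ : Literature.NumberTheory.GaloisRepresentations.FramedGaloisRep M ℂ 2) (τ₂ : Literature.NumberTheory.GaloisRepresentations.FramedGaloisRep M (PadicAlgCl 2) 2), (∀ g : Field.absoluteGaloisGroup M, ((τ₂ g : Matrix.GeneralLinearGroup (Fin 2) (PadicAlgCl 2)) : Matrix (Fin 2) (Fin 2) (PadicAlgCl 2)).map ι = ((τ g : Matrix.GeneralLinearGroup (Fin 2) ℂ) : Matrix (Fin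 2) (Fin 2) ℂ)) → Finite τ₂.toMonoidHom.range → Nonempty ((Matrix.ProjGenLinGroup.mk.comp τ₂.toMonoidHom).range ≃* alternatingGroup (Fin 5)) → ∀ 𝒰 : Literature.NumberTheory.Automorphic.BigHeckeGLn.TameLevel 2 M 2, 𝒰.IsPadicallyAutomorphic τ₂ → ∃ (hM : Literature.NumberTheory.Automorphic.isCompact_glFiniteIntegralLevel 2 M) (π : Literature.NumberTheory.Automorphic.CuspidalAutomorphicRepData 2 M hM), (∀ᶠ w : IsDedekindDomain.HeightOneSpectrum (NumberField.RingOfIntegers M) in Filter.cofinite, ∃ α : Multiset ℂ, π.1.HasSatakeParamAt w α ∧ τ.IsUnramifiedAt w ∧ τ.HasFrobCharpolyAt w (Literature.NumberTheory.Automorphic.satakePolynomial α)) ∧ (∀ w : IsDedekindDomain.HeightOneSpectrum (NumberField.RingOfIntegers M), w ∉ 𝒰.bad → ∃ α : Multiset ℂ, π.1.HasSatakeParamAt w α ∧ τ.IsUnramifiedAt w ∧ τ.HasFrobCharpolyAt w (Literature.NumberTheory.Automorphic.satakePolynomial α))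

/-- **D₃♭ `CofinalResidualDoorOffDyadic`** (v4) — D∞' `CofinalResidualDoor` RESTRICTED to the `2`-bad sub-sector (extra
hypothesis: `σ` is not `2`-good).  WEAKER than D∞' (`cofinalResidualDoorOffDyadic_of_cofinalResidualDoor`).  Leaf
IDEA-NEEDED (the v3 door T3, now only for `σ` ramified at `2` or with projective `Frob₂` of order `1` or `2`).  Why it
might fail: as D∞' (Serre-type conjecture over CM fields for restrictions of even `ρ̄`).  [arXiv:1204.6697 §11.1;
arXiv:1910.12986] -/
def CofinalResidualDoorOffDyadic : Prop :=
  ∀ (ι : PadicAlgCl 3 ≃+* ℂ) (σ : Literature.NumberTheory.GaloisRepresentations.FramedGaloisRep ℚ ℂ 2), σ.toGaloisRep.IsIrreducible → Nonempty ((Matrix.ProjGenLinGroup.mk.comp σ.toMonoidHom).range ≃* alternatingGroup (Fin 5)) → (∀ (φ : ℚ →+* ℝ) (c : Field.absoluteGaloisGroup ℚ), Literature.NumberTheory.GaloisRepresentations.IsComplexConjugation φ c → Matrix.GeneralLinearGroup.det (σ c) = 1) → (∀ v : IsDedekindDomain.HeightOneSpectrum (NumberField.RingOfIntegers ℚ),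 (3 : NumberField.RingOfIntegers ℚ) ∈ v.asIdeal → σ.IsUnramifiedAt v ∧ ∃ t d : ℂ, σ.HasFrobCharpolyAt v (Polynomial.X ^ 2 - Polynomial.C t * Polynomial.X + Polynomial.C d) ∧ t ^ 2 ≠ d ∧ t ^ 2 ≠ 4 * d) → (¬ ∀ v : IsDedekindDomain.HeightOneSpectrum (NumberField.RingOfIntegers ℚ), (2 : NumberField.RingOfIntegers ℚ) ∈ v.asIdeal → σ.IsUnramifiedAt v ∧ ∃ t d : ℂ, σ.HasFrobCharpolyAt v (Polynomial.X ^ 2 - Polynomial.C t * Polynomial.X + Polynomial.C d) ∧ t ≠ 0 ∧ t ^ 2 ≠ 4 * d) → ∀ᶠ p : IsDedekindDomain.HeightOneSpectrum (NumberField.RingOfIntegers ℚ) in Filter.cofinite, ∃ (M : Type) (_ : Field M) (_ : NumberField M), NumberField.IsCMField M ∧ IsGalois ℚ M ∧ IsCyclic (M ≃ₐ[ℚ] M) ∧ Squarefree (Module.finrank ℚ M) ∧ (∀ ℓ : ℕ, ℓ.Prime → ℓ ∣ Module.finrank ℚ M → ℓ = 2 ∨ (2 ^ Ideal.absNorm p.asIdeal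 ≤ ℓ ∧ ℓ < 2 ^ (Ideal.absNorm p.asIdeal + 1))) ∧ (∀ w : IsDedekindDomain.HeightOneSpectrum (NumberField.RingOfIntegers M), w.asIdeal.under (NumberField.RingOfIntegers ℚ) = p.asIdeal → w.asIdeal.inertiaDeg (NumberField.RingOfIntegers ℚ) = 1 ∧ w.asIdeal.ramificationIdx (NumberField.RingOfIntegers ℚ) = 1) ∧ (∃ (d : ℕ) (z : M), d % 3 = 2 ∧ z ^ 2 + (d : M) = 0) ∧ (∀ z : M, z ^ 2 + z + 1 ≠ 0) ∧ ∃ (χ : Literature.NumberTheory.GaloisRepresentations.FramedGaloisRep M ℂ 1) (τ : Literature.NumberTheory.GaloisRepresentations.FramedGaloisRep M ℂ 2) (τ₃ : Literature.NumberTheory.GaloisRepresentations.FramedGaloisRep M (PadicAlgCl 3) 2), (∀ g : Field.absoluteGaloisGroup M, ((τ g : Matrix.GeneralLinearGroup (Fin 2) ℂ) : Matrix (Fin 2) (Fin 2) ℂ) = ((Matrix.GeneralLinearGroup.det (χ g) : ℂˣ) : ℂ) • ((Literature.NumberTheory.GaloisRepresentations.FramedGaloisRep.restrictField M σ g : Matrix.GeneralLinearGroup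 (Fin 2) ℂ) : Matrix (Fin 2) (Fin 2) ℂ)) ∧ (∀ g : Field.absoluteGaloisGroup M, ((τ₃ g : Matrix.GeneralLinearGroup (Fin 2) (PadicAlgCl 3)) : Matrix (Fin 2) (Fin 2) (PadicAlgCl 3)).map ι = ((τ g : Matrix.GeneralLinearGroup (Fin 2) ℂ) : Matrix (Fin 2) (Fin 2) ℂ)) ∧ Finite τ₃.toMonoidHom.range ∧ (∀ w : IsDedekindDomain.HeightOneSpectrum (NumberField.RingOfIntegers M), w.asIdeal.under (NumberField.RingOfIntegers ℚ) = p.asIdeal → χ.IsUnramifiedAt w ∧ τ₃.IsUnramifiedAt w) ∧ (Nonempty ((Matrix.ProjGenLinGroup.mk.comp τ₃.toMonoidHom).range ≃* alternatingGroup (Fin 5)) ∧ (∀ w : IsDedekindDomain.HeightOneSpectrum (NumberField.RingOfIntegers M), (3 : NumberField.RingOfIntegers M) ∈ w.asIdeal → τ₃.IsUnramifiedAt w ∧ ∃ t d : PadicAlgCl 3, τ₃.HasFrobCharpolyAt w (Polynomial.X ^ 2 - Polynomial.C t * Polynomial.X + Polynomial.C d) ∧ ‖t ^ 2 - 4 *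 d‖ = 1) ∧ ∃ 𝒰 : Literature.NumberTheory.Automorphic.BigHeckeGLn.TameLevel 2 M 3, ∃ 𝔪 : Ideal (Literature.NumberTheory.Automorphic.CompletedCohomologyHeckeAlgebraGLn 𝒰), 𝒰.IsNonEisenstein 𝔪 ∧ ∃ (k : Type) (_ : Field k) (_ : TopologicalSpace k) (_ : DiscreteTopology k) (ιk : Literature.NumberTheory.GaloisRepresentations.padicAlgClResidueField 3 →+* k) (ψ : Literature.NumberTheory.Automorphic.CompletedCohomologyHeckeAlgebraGLn 𝒰 →+* k) (ρ : Literature.NumberTheory.GaloisRepresentations.FramedGaloisRep M k 2), 𝒰.IsResidualRepAt 𝔪 ψ ρ ∧ τ₃.IsReductionOf ιk (ρ : Field.absoluteGaloisGroup M →* Matrix.GeneralLinearGroup (Fin 2) k))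

open scoped MatrixGroups
open NumberField IsDedekindDomain Filter
open Literature.NumberTheory.GaloisRepresentations Literature.NumberTheory.Automorphic

/-! ### Certificate: the restricted `3`-adic door is below the v3 door -/

/-- D∞' ⟹ D₃♭ (drop the extra hypothesis). [folklore] -/
theorem cofinalResidualDoorOffDyadic_of_cofinalResidualDoor (hD : CofinalResidualDoor) :
    CofinalResidualDoorOffDyadic :=
  fun ι σ hirr hico heven h3 _ ↦ hD ι σ hirr hico heven h3

/-! ### The deciding theorems of the node (v4) -/

/-- **`langlands_of_pieces_dyadic`** — the node's deciding theorem: the dyadic door/engine/wall, the restricted `3`-adic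
door with the v3 engine/wall, the pointwise untwist, the cyclic descent, the route's residual complement and its junction
imply `Langlands`.  The v3 glue run twice under `by_cases` on `2`-goodness of `σ`. -/
theorem langlands_of_pieces_dyadic (hD₂ : CofinalResidualDoorTwo) (hE₂ : ShapePreservingResidualEngineTwo)
    (hF₂ : ClassicalityOffBadPlacesTwo) (hD : CofinalResidualDoorOffDyadic) (hE : ShapePreservingResidualEngine)
    (hF : ClassicalityOffBadPlaces) (hG : UntwistAutomorphyAt) (hH : CofinalCyclicDescent) (hC : NonDistinguishedComplement)
    (hJ : SectorJunction) : _root_.Langlands := by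
  obtain ⟨ι₂⟩ := PadicAlgCl.nonempty_ringEquiv_complex 2
  obtain ⟨ι⟩ := PadicAlgCl.nonempty_ringEquiv_complex 3
  refine hJ fun σ hirr hico heven ↦ ?_
  by_cases h2 : ∀ v : IsDedekindDomain.HeightOneSpectrum (NumberField.RingOfIntegers ℚ), (2 : NumberField.RingOfIntegers ℚ) ∈ v.asIdeal → σ.IsUnramifiedAt v ∧ ∃ t d : ℂ, σ.HasFrobCharpolyAt v (Polynomial.X ^ 2 - Polynomial.C t * Polynomial.X + Polynomial.C d) ∧ t ≠ 0 ∧ t ^ 2 ≠ 4 * d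
  · -- the 2-good sub-sector: dyadic door → dyadic engine → dyadic wall → pointwise untwist, prime by prime
    refine hH σ hirr hico ?_
    filter_upwards [hD₂ ι₂ σ hirr hico heven h2] with p hp
    obtain ⟨M, _, _, hCM, hGal, hCyc, hSq, hWin, hSplit, hK2, χ, τ, τ₂, htw, hav, hfin, hunr, hhyp⟩ := hp
    obtain ⟨M', _, _, _, hCM', hGal', hCyc', hSq', hWin', hSplit', hfin', hico', 𝒰, hbad, hpa⟩ :=
      hE₂ M p hCM hGal hCyc hSq hWin hSplit hK2 τ₂ hfin (fun w hw ↦ (hunr w hw).2) hhyp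
    obtain ⟨hM'c, π', hae, hpt⟩ := hF₂ ι₂ M' hCM' (τ.restrictField M') (τ₂.restrictField M')
      (fun g ↦ hav _) hfin' hico' 𝒰 hpa
    -- `χ|_{M'}` is unramified above `p`
    have hT : ∀ w' ∈ {w' : HeightOneSpectrum (𝓞 M') | w'.asIdeal.under (𝓞 ℚ) = p.asIdeal},
        (χ.restrictField M').IsUnramifiedAt w' := by
      intro w' hw'
      obtain ⟨w, hw⟩ := exists_under_eq (F := M) w'
      have hwp : w.asIdeal.under (𝓞 ℚ) = p.asIdeal := by
        rw [← hw, Ideal.under_under]; exact hw'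
      exact χ.isUnramifiedAt_restrictField hw (hunr w hwp).1
    obtain ⟨hM'', π'', hae', hpt'⟩ := hG M' ((σ.restrictField M).restrictField M') (τ.restrictField M')
      (χ.restrictField M') {w' | w'.asIdeal.under (𝓞 ℚ) = p.asIdeal} (fun g ↦ htw _) hT
      ⟨hM'c, π', hae, fun w' hw' ↦ hpt w' (hbad w' hw')⟩
    exact ⟨M, inferInstance, inferInstance, M', inferInstance, inferInstance, inferInstance, hCM', hGal', hCyc', hSq',
      hWin', hSplit', hM'', π'', hae', fun w' hw' ↦ hpt' w' hw'⟩
  · by_cases h3 : ∀ v : IsDedekindDomain.HeightOneSpectrum (NumberField.RingOfIntegers ℚ), (3 : NumberField.RingOfIntegers ℚ) ∈ v.asIdeal → σ.IsUnramifiedAt v ∧ ∃ t d : ℂ, σ.HasFrobCharpolyAt v (Polynomial.X ^ 2 - Polynomial.C t * Polynomial.X + Polynomial.C d) ∧ t ^ 2 ≠ d ∧ t ^ 2 ≠ 4 * d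
    · -- the 2-bad, 3-good sub-sector: the v3 chain with the restricted door
      refine hH σ hirr hico ?_
      filter_upwards [hD ι σ hirr hico heven h3 h2] with p hp
      obtain ⟨M, _, _, hCM, hGal, hCyc, hSq, hWin, hSplit, hK3, hζ, χ, τ, τ₃, htw, hav, hfin, hunr, hhyp⟩ := hp
      obtain ⟨M', _, _, _, hCM', hGal', hCyc', hSq', hWin', hSplit', hfin', hico', 𝒰, hbad, hpa⟩ :=
        hE M p hCM hGal hCyc hSq hWin hSplit hK3 hζ τ₃ hfin (fun w hw ↦ (hunr w hw).2) hhyp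
      obtain ⟨hM'c, π', hae, hpt⟩ := hF ι M' hCM' (τ.restrictField M') (τ₃.restrictField M')
        (fun g ↦ hav _) hfin' hico' 𝒰 hpa
      -- `χ|_{M'}` is unramified above `p`
      have hT : ∀ w' ∈ {w' : HeightOneSpectrum (𝓞 M') | w'.asIdeal.under (𝓞 ℚ) = p.asIdeal},
          (χ.restrictField M').IsUnramifiedAt w' := by
        intro w' hw'
        obtain ⟨w, hw⟩ := exists_under_eq (F := M) w'
        have hwp : w.asIdeal.under (𝓞 ℚ) = p.asIdeal := by
          rw [← hw, Ideal.under_under]; exact hw'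
        exact χ.isUnramifiedAt_restrictField hw (hunr w hwp).1
      obtain ⟨hM'', π'', hae', hpt'⟩ := hG M' ((σ.restrictField M).restrictField M') (τ.restrictField M')
        (χ.restrictField M') {w' | w'.asIdeal.under (𝓞 ℚ) = p.asIdeal} (fun g ↦ htw _) hT
        ⟨hM'c, π', hae, fun w' hw' ↦ hpt w' (hbad w' hw')⟩
      exact ⟨M, inferInstance, inferInstance, M', inferInstance, inferInstance, inferInstance, hCM', hGal', hCyc', hSq',
        hWin', hSplit', hM'', π'', hae', fun w' hw' ↦ hpt' w' hw'⟩
    · exact hC σ hirr hico heven h3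

/-- **`closes_target_dyadic`** — the deciding theorem with the decided leaf G∞ discharged in kernel: NINE binders
(D₂, E₂, F₂, D₃♭, E∞', F∞, H∞, C, J) imply `Langlands`. -/
theorem closes_target_dyadic (hD₂ : CofinalResidualDoorTwo) (hE₂ : ShapePreservingResidualEngineTwo)
    (hF₂ : ClassicalityOffBadPlacesTwo) (hD : CofinalResidualDoorOffDyadic) (hE : ShapePreservingResidualEngine)
    (hF : ClassicalityOffBadPlaces) (hH : CofinalCyclicDescent) (hC : NonDistinguishedComplement) (hJ : SectorJunction) :
    _root_.Langlands :=
  langlands_of_pieces_dyadic hD₂ hE₂ hF₂ hD hE hF untwistAutomorphyAt_proof hH hC hJ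

/-- **v4 asks nothing new of the `3`-adic side**: the v3 binders (with the FULL door D∞') plus the three dyadic pieces
give `Langlands` through the v4 kernel. [folklore] -/
theorem closes_target_dyadic_of_v3 (hD₂ : CofinalResidualDoorTwo) (hE₂ : ShapePreservingResidualEngineTwo)
    (hF₂ : ClassicalityOffBadPlacesTwo) (hD : CofinalResidualDoor) (hE : ShapePreservingResidualEngine)
    (hF : ClassicalityOffBadPlaces) (hH : CofinalCyclicDescent) (hC : NonDistinguishedComplement) (hJ : SectorJunction) :
    _root_.Langlands :=
  closes_target_dyadic hD₂ hE₂ hF₂ (cofinalResidualDoorOffDyadic_of_cofinalResidualDoor hD) hE hF hH hC hJ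

end Summit.Langlands.Langlands.Theorems.SplitPrimeDescentLadder

end
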